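import Summits.Ventures.KdS.RouteWRealAxisHighSpin
import Literature.Geometry.Lorentzian.SchwarzschildDeSitterScalarModeStability
import HarnessLib

/-!
# Venture KdS — the `a = 0` face: Schwarzschild–de Sitter is mode stable for the Teukolsky
# equation of every half-integer spin `s ≤ 1/2` (route W), with the angular input for every spin

HONEST FRAMING (venture `Summits/Ventures/KdS`, cell `pub-kds`; optional kernel object of the
Monday S3 seat; one screen over LANDED files: `RouteWEulerRL.radial_vanishing_lt_one` (route W,
`s < 1`), `RouteWRealAxisHighSpin.{theorem310_bullet1, realAxis_vanishing_allSpins,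
pairCondition_p3}` (LIT-1 g23), the angular boundary-flux lemma `im_conj_mul_nonpos_of_angularODE`
and the `a = 0` horizon facts of `SchwarzschildDeSitterScalarModeStability`, whose docstring lists
"`s ≠ 0` at `a = 0`" as NOT in the tree). At `a = 0` the Hatsuda/STU angular equation is the
spin-weighted spherical one: `V(x) − λ̄ = −(m + sx)²/(1 − x²)` (`angularPotential_zero_a_sub`), so
the flux lemma gives `Im(c̄λ̄) ≤ 0` for every `Im c > 0` (`angularSign_zero_a`) and hence `λ̄` real,
`≥ 0` (`lambdaBar_zero_a_real_nonneg`) — the `a = 0` substitute for CTdC Lemma 3.1, every spin; the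
superradiant windows are empty (`Ω_low = Ω_SR = 0`). Consequences (0 facts):
* `not_hasMode_zero_a_real` — NO real-frequency mode (`ω ∈ ℝ∖{0}`) of ANY half-integer spin on
  Schwarzschild–de Sitter (`realAxis_vanishing_allSpins`; its regime disjunct `Re ω ≠ m·0` is
  `ω ≠ 0` here);
* `not_hasMode_zero_a_of_lt_one` — no mode with `Im ω > 0` for `s < 1` (`radial_vanishing_lt_one`;
  for `s ≥ 1` the imaginary axis `Re ω = 0 = mϖ₁` is the event threshold ray, closed only by
  `RouteW.NonExtremeStrata` — see `RouteWUpperHalfPlane`);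
* ★ `modeStable_zero_a_of_lt_one` — `ModeStable M 0 Λ s` (no mode with `Im ω ≥ 0`, `ω ≠ 0`, CTdC
  Def. 3.4 as typed) for every subextremal `(M, 0, Λ)` and every half-integer `s < 1`, i.e.
  `s ∈ {1/2, 0, −1/2, −1, −3/2, −2, …}` — including the Teukolsky equations of NEGATIVE spin weight
  `s = −1/2, −1, −2` (neutrino, Maxwell, linearised gravity); the tree had `s = 0` only
  (`modeStable_zero_a`). Printed-range forms over `0 < 9ΛM² < 1`.
"ingoing/outgoing" are the tree's generic-bullet predicates (CTdC Def. 3.3 AS TYPED); nothing here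
is a statement about `a > 0`, nonlinear stability or the Final State Conjecture. 0 cited facts,
no `sorry`.
-/

noncomputable section

open Set Complex

namespace Summit.Ventures.KdS

namespace RouteW

open Literature.Geometry.Lorentzian Literature.Geometry.Lorentzian.KerrDeSitter

/-! ### The angular input at `a = 0`, every spin -/

/-- The Hatsuda/STU angular potential at `a = 0` (`α = 0`, `Ξ = 1`, `c = aω = 0`):
`V(x) − λ̄ = −(m + s x)²/(1 − x²)` with `λ̄ = λ − s` (spin-weighted spherical harmonics).
[cite: CasalsTeixeiradacosta2022, Lemma 3.1 (proof, at ν = 0)] -/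
theorem angularPotential_zero_a_sub (Λ s : ℝ) (ω : ℂ) (m : ℝ) (lam : ℂ) (x : ℝ) :
    angularPotential 0 Λ s ω m lam x - lambdaBar 0 Λ s ω m lam =
      -((((m + s * x) ^ 2 / (1 - x ^ 2) : ℝ)) : ℂ) := by
  simp only [angularPotential, lambdaBar, alpha, xi]
  push_cast
  ring

/-- **The angular sign at `a = 0`, every spin**: for an angular eigenvalue `λ` of the `c = aω = 0`
equation and every `c` with `Im c > 0`, `Im(c̄ λ̄) ≤ 0` (the tree's boundary-flux lemma
`im_conj_mul_nonpos_of_angularODE` with `V − λ̄ = −(m + sx)²/(1 − x²) ≤ 0`).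
[cite: CasalsTeixeiradacosta2022, Lemma 3.1 (proof, at ν = 0)] -/
theorem angularSign_zero_a {Λ s : ℝ} {ω : ℂ} {m : ℝ} {lam : ℂ}
    (hang : IsAngularEigenvalue 0 Λ s ω m lam) {c : ℂ} (hc : 0 < c.im) :
    ((starRingEnd ℂ) c * lambdaBar 0 Λ s ω m lam).im ≤ 0 := by
  obtain ⟨S, ⟨S', S'', hS⟩, hreg, hnt⟩ := hang
  have hα : 0 ≤ alpha 0 Λ := by simp [alpha]
  refine im_conj_mul_nonpos_of_angularODE hα hc (s := s) (m := m)
    (V := angularPotential 0 Λ s ω m lam) (lamBar := lambdaBar 0 Λ s ω m lam) hS hreg hnt ?_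
  intro x hx
  have hN : 0 ≤ (m + s * x) ^ 2 / (1 - x ^ 2) :=
    div_nonneg (sq_nonneg _) (by nlinarith [hx.1, hx.2])
  rw [angularPotential_zero_a_sub, mul_neg, Complex.neg_im, mul_im, Complex.conj_re,
    Complex.conj_im, ofReal_re, ofReal_im]
  nlinarith

/-- **At `a = 0` every angular eigenvalue has `λ̄` real and non-negative** (any `ω`, every spin):
`Im((t − i)λ̄) = t·Im λ̄ − Re λ̄ ≤ 0` for all real `t` (`angularSign_zero_a` at `c = t + i`).
[cite: CasalsTeixeiradacosta2022, Lemma 3.1] -/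
theorem lambdaBar_zero_a_real_nonneg {Λ s : ℝ} {ω : ℂ} {m : ℝ} {lam : ℂ}
    (hang : IsAngularEigenvalue 0 Λ s ω m lam) :
    (lambdaBar 0 Λ s ω m lam).im = 0 ∧ 0 ≤ (lambdaBar 0 Λ s ω m lam).re := by
  set L := lambdaBar 0 Λ s ω m lam with hL
  have key : ∀ t : ℝ, t * L.im - L.re ≤ 0 := by
    intro t
    have h := angularSign_zero_a hang (c := (t : ℂ) + I) (by simp)
    have e : ((starRingEnd ℂ) ((t : ℂ) + I) * L).im = t * L.im - L.re := by
      rw [map_add, Complex.conj_ofReal, Complex.conj_I, mul_im, add_re, add_im, ofReal_re,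
        ofReal_im, Complex.neg_re, Complex.neg_im, Complex.I_re, Complex.I_im]
      ring
    rw [← hL, e] at h
    exact h
  refine ⟨?_, by have := key 0; linarith⟩
  by_contra hne
  have h := key ((L.re + 1) / L.im)
  rw [div_mul_cancel₀ _ hne] at h
  linarith

/-- `Ω_SR = 0` at `a = 0`. -/
theorem superradiantUpper_zero_a (M Λ : ℝ) : superradiantUpper M 0 Λ = 0 := by
  simp [superradiantUpper]

/-- `Ω_low = 0` at `a = 0`. -/
theorem superradiantLower_zero_a (M Λ : ℝ) : superradiantLower M 0 Λ = 0 := by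
  simp [superradiantLower]

/-- At `a = 0` the angular sign hypothesis `Im(λ̄ω̄) ≤ 0` of CTdC Prop. 3.8 / Thm 3.10 holds for
every angular eigenvalue and every `Im ω > 0`. -/
theorem im_lambdaBar_mul_conj_nonpos_zero_a {Λ s : ℝ} {ω : ℂ} {m : ℝ} {lam : ℂ}
    (hang : IsAngularEigenvalue 0 Λ s ω m lam) (hω : 0 < ω.im) :
    (lambdaBar 0 Λ s ω m lam * (starRingEnd ℂ) ω).im ≤ 0 := by
  rw [mul_comm]; exact angularSign_zero_a hang hω

/-- At `a = 0` the superradiant-window escape `0 < |ω| < |m|·Ω_SR` is impossible. -/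
theorem not_window_zero_a (M Λ : ℝ) (ω : ℂ) (m : ℝ) :
    ¬(0 < ‖ω‖ ∧ ‖ω‖ < |m| * superradiantUpper M 0 Λ) := by
  rw [superradiantUpper_zero_a, mul_zero]
  exact fun h => absurd h.2 (not_lt.2 (norm_nonneg ω))

/-! ### Schwarzschild–de Sitter: no modes, `s < 1` on the open half-plane, every spin on the
real axis -/

/-- **No real-frequency Teukolsky mode on Schwarzschild–de Sitter, ANY half-integer spin**
(`a = 0`, `ω ∈ ℝ∖{0}`, any real `m`): `λ̄` is real, the window clause is vacuous
(`Ω_low = Ω_SR = 0`), and the regime disjunct `Re ω ≠ m·ϖ₁ = 0` of `realAxis_vanishing_allSpins`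
is `ω ≠ 0` itself. PROVED, 0 cited facts. [cite: Hintz2021KdSModes, §1.2] -/
theorem not_hasMode_zero_a_real {M Λ s : ℝ} {ω : ℂ} {m : ℝ} (hsub : IsSubextremal M 0 Λ)
    (h2s : ∃ k : ℤ, 2 * s = k) (hω : ω.im = 0) (hω0 : ω ≠ 0) : ¬HasMode M 0 Λ s ω m := by
  rintro ⟨lam, R, hang, hR, hin, hout, hnt⟩
  have hlam := (lambdaBar_zero_a_real_nonneg hang).1
  have hthird : m = 0 ∨
      ¬(superradiantLower M 0 Λ < ω.re / m ∧ ω.re / m < superradiantUpper M 0 Λ) := by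
    refine Or.inr ?_
    rw [superradiantLower_zero_a, superradiantUpper_zero_a]
    exact fun h => absurd (h.1.trans h.2) (lt_irrefl 0)
  have h1 : ω.re ≠ m * horizonAngVel 0 (rPlus M 0 Λ) ∨ s ≤ 0 := by
    refine Or.inl ?_
    rw [horizonAngVel_zero_a, mul_zero]
    intro hre
    exact hω0 (Complex.ext hre hω)
  obtain ⟨r, hr, hne⟩ := hnt
  exact hne (realAxis_vanishing_allSpins hsub le_rfl h2s hω hω0 hlam hthird h1 hR hin hout r hr)

/-- **No growing Teukolsky mode on Schwarzschild–de Sitter for spin `s < 1`** (`a = 0`, `Im ω > 0`,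
any real `m`): route W (`radial_vanishing_lt_one`) with `Im(λ̄ω̄) ≤ 0` from `angularSign_zero_a`,
`p₃ = pairCondition_p3`, and the empty window. PROVED, 0 cited facts.
[cite: Hintz2021KdSModes, §1.2] -/
theorem not_hasMode_zero_a_of_lt_one {M Λ s : ℝ} {ω : ℂ} {m : ℝ} (hsub : IsSubextremal M 0 Λ)
    (hs : s < 1) (hω : 0 < ω.im) : ¬HasMode M 0 Λ s ω m := by
  rintro ⟨lam, R, hang, hR, hin, hout, hnt⟩
  obtain ⟨r, hr, hne⟩ := hnt
  exact hne (radial_vanishing_lt_one hsub le_rfl hs hω (im_lambdaBar_mul_conj_nonpos_zero_a hang hω)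
    (not_window_zero_a M Λ ω m) (pairCondition_p3 hsub le_rfl hω.le m) hR hin hout r hr)

/-- ★ **Mode stability of Schwarzschild–de Sitter for the Teukolsky equation of every half-integer
spin `s < 1`** — `s ∈ {1/2, 0, −1/2, −1, −3/2, −2, …}`, in particular the negative-spin-weight
neutrino, Maxwell and linearised-gravity equations `s = −1/2, −1, −2`: `ModeStable M 0 Λ s` (no
mode with `Im ω ≥ 0`, `ω ≠ 0`, CTdC Def. 3.4 as typed) for every subextremal `(M, 0, Λ)`. (The
tree's `modeStable_zero_a` is `s = 0`; every spin `s ≥ 1` follows in `RouteWUpperHalfPlane` from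
`RouteW.NonExtremeStrata`.) PROVED, 0 cited facts. [cite: Hintz2021KdSModes, §1.2] -/
theorem modeStable_zero_a_of_lt_one {M Λ s : ℝ} (hsub : IsSubextremal M 0 Λ) (hs : s < 1)
    (h2s : ∃ k : ℤ, 2 * s = k) : ModeStable M 0 Λ s := by
  intro ω m hW _ hmode
  rcases (hW.1 : 0 ≤ ω.im).lt_or_eq with hlt | heq
  · exact not_hasMode_zero_a_of_lt_one hsub hs hlt hmode
  · exact not_hasMode_zero_a_real hsub h2s heq.symm hW.2 hmode

/-- The same over the printed range: every Schwarzschild–de Sitter black hole (`M > 0`, `Λ > 0`,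
`9ΛM² < 1`) is mode stable for the spin-`s` Teukolsky equation, every half-integer `s < 1`.
[cite: Hintz2021KdSModes, §1.1–§1.2] -/
theorem modeStable_schwarzschildDeSitter_of_lt_one {M Λ s : ℝ} (hM : 0 < M) (hΛ : 0 < Λ)
    (h9 : 9 * Λ * M ^ 2 < 1) (hs : s < 1) (h2s : ∃ k : ℤ, 2 * s = k) : ModeStable M 0 Λ s :=
  modeStable_zero_a_of_lt_one (isSubextremal_zero_a_iff.2 ⟨hM, hΛ, h9⟩) hs h2s

/-- **Linearised gravity (`s = −2`) on Schwarzschild–de Sitter is mode stable** (Teukolsky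
equation, `Im ω ≥ 0`, `ω ≠ 0`), over the printed range `0 < 9ΛM² < 1`.
[cite: Hintz2021KdSModes, §1.1–§1.2] -/
theorem modeStable_schwarzschildDeSitter_gravity {M Λ : ℝ} (hM : 0 < M) (hΛ : 0 < Λ)
    (h9 : 9 * Λ * M ^ 2 < 1) : ModeStable M 0 Λ (-2) :=
  modeStable_schwarzschildDeSitter_of_lt_one hM hΛ h9 (by norm_num) ⟨-4, by norm_num⟩

/-- Box form: spin-`s` mode stability on the Schwarzschild–de Sitter family
`{(M, 0, Λ) : M > 0, Λ > 0, 9ΛM² < 1}` (`ModeStableOn`), every half-integer `s < 1`.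
[cite: Hintz2021KdSModes, §1.1–§1.2] -/
theorem modeStableOn_schwarzschildDeSitter_of_lt_one {s : ℝ} (hs : s < 1)
    (h2s : ∃ k : ℤ, 2 * s = k) :
    ModeStableOn {p : ℝ × ℝ × ℝ | 0 < p.1 ∧ p.2.1 = 0 ∧ 0 < p.2.2 ∧ 9 * p.2.2 * p.1 ^ 2 < 1} s := by
  rintro ⟨M, a, Λ⟩ ⟨hM, ha, hΛ, h9⟩
  dsimp only at hM ha hΛ h9 ⊢
  subst ha
  exact modeStable_schwarzschildDeSitter_of_lt_one hM hΛ h9 hs h2s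

end RouteW

end Summit.Ventures.KdS
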